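import Literature.AlgebraicGeometry.CossartJannsenSaito2020.KeyTheoremsIsolated
import HarnessLib

/-!
# CJS LNM 2270, Key Theorems — isolation implies the typed hypothesis; the `𝒪_{X,x}`-read forms imply the ISOLATED forms

Companion PROOF file of `KeyTheorems.lean` / `KeyTheoremsIsolated.lean` (Cossart–Jannsen–Saito, LNM 2270 (2020)
[`CossartJannsenSaito2020`], Thm. 6.40 with its parenthetical «(which holds if `x^{(i)}` is isolated in `(X^{(i)})^O_max`)»,
Def. 13.3 «this holds in particular if `x` is isolated in `{ξ ∈ X | H^O_X(ξ) ≥ H^O_X(x)}`»). PROVED here, for the typed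
boundary-free renderings: isolation of `x` in the Hilbert–Samuel locus (`IsIsolatedInHSMaxLocus`) implies the hypothesis
`NoRegularSubschemeInHSLocus X N x d` for every `d ≥ 1` (no one-or-higher-dimensional closed subscheme of `Spec 𝒪_{X,x}`
inside `{H ≥ H(x)}`), hence the named facts `KeyTheorem640` / `KeyTheorem640_char` (hypothesis read in `𝒪_{X,x}`) imply
their ISOLATED siblings `KeyTheorem640_isolated` / `KeyTheorem640_char_isolated`, and `KeyTheorem635` implies finiteness
of fundamental sequences over isolated points. Nothing about the Key Theorems themselves is proved.
-/

noncomputable section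

open CategoryTheory AlgebraicGeometry TopologicalSpace IsLocalRing Topology
open Literature.AlgebraicGeometry.Resolution

namespace Literature.AlgebraicGeometry.CossartJannsenSaito2020

universe u

/-- **Isolation in the Hilbert–Samuel locus implies the typed hypothesis of the Key Theorems in every dimension
`d ≥ 1`** (the parenthetical of Thm. 6.40 / Def. 13.3 «this holds in particular if `x` is isolated …», for the
rendering `NoRegularSubschemeInHSLocus` read in `𝒪_{X,x}`): a closed subscheme `Spec(𝒪_{X,x}/I)` of dimension `≥ 1`
contains a non-maximal prime `𝔮 ⊇ I`; the corresponding generization `ξ ≠ x` of `x` (Mathlib `Scheme.fromSpecStalk`,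
`range_fromSpecStalk`) would have `H_X(ξ) ≥ H_X(x)` with `H_X(x)` maximal, so `ξ ∈ X_max`, and `ξ` lies in every open
neighbourhood of `x` — contradicting `U ∩ X_max = {x}`. [cite: CossartJannsenSaito2020, Thm. 6.40, Def. 13.3] -/
theorem noRegularSubschemeInHSLocus_of_isolated {X : Scheme.{u}} [IsLocallyNoetherian X] {N : ℕ} {x : X}
    (hx : IsIsolatedInHSMaxLocus X N x) {d : ℕ} (hd : 1 ≤ d) : NoRegularSubschemeInHSLocus X N x d := by
  rintro ⟨I, -, hdim, hH⟩
  obtain ⟨U, hU, hUx⟩ := hx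
  have hxU : x ∈ U ∩ Scheme.hsMaxLocus X N := by rw [hUx]; exact Set.mem_singleton x
  -- a non-maximal prime containing `I`
  have h1 : (1 : WithBot ℕ∞) ≤ ringKrullDim (X.presheaf.stalk x ⧸ I) := by
    rw [hdim]; exact_mod_cast hd
  rw [ringKrullDim_quotient, Order.one_le_krullDim_iff] at h1
  obtain ⟨⟨𝔮, h𝔮⟩, ⟨𝔮', h𝔮'⟩, hlt⟩ := h1
  have hne : 𝔮.asIdeal ≠ maximalIdeal (X.presheaf.stalk x) := by
    intro h
    have hle : 𝔮'.asIdeal ≤ 𝔮.asIdeal := h ▸ IsLocalRing.le_maximalIdeal 𝔮'.isPrime.ne_top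
    exact (lt_irrefl _ (lt_of_lt_of_le hlt hle))
  -- the generization `ξ` of `x`
  set ξ : X := (X.fromSpecStalk x).base 𝔮 with hξ
  have hHξ : Scheme.hsFun X N x ≤ Scheme.hsFun X N ξ := hH 𝔮 h𝔮
  have hspec : ξ ⤳ x := by
    have : ξ ∈ Set.range (X.fromSpecStalk x).base := ⟨𝔮, rfl⟩
    rw [Scheme.range_fromSpecStalk] at this
    exact this
  have hξU : ξ ∈ U := hspec.mem_open hU hxU.1
  -- `ξ ∈ X_max`
  have hxmax : Maximal (· ∈ Scheme.hsValues X N) (Scheme.hsFun X N x) :=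
    Scheme.mem_hsMaxLocus_iff.1 hxU.2
  have hξval : Scheme.hsFun X N ξ ∈ Scheme.hsValues X N := ⟨ξ, rfl⟩
  have heq : Scheme.hsFun X N ξ = Scheme.hsFun X N x := le_antisymm (hxmax.2 hξval hHξ) hHξ
  have hξmax : ξ ∈ Scheme.hsMaxLocus X N := by
    rw [Scheme.mem_hsMaxLocus_iff, heq]; exact hxmax
  have hξx : ξ = x := by
    have : ξ ∈ U ∩ Scheme.hsMaxLocus X N := ⟨hξU, hξmax⟩
    rw [hUx] at this
    exact this
  -- but `𝔮 ≠ 𝔪`, and `fromSpecStalk` is injective on points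
  apply hne
  have hinj : Function.Injective (X.fromSpecStalk x).base := (X.fromSpecStalk x).isEmbedding.injective
  have : 𝔮 = closedPoint (X.presheaf.stalk x) := by
    apply hinj
    rw [← hξ, hξx]
    exact (Scheme.fromSpecStalk_closedPoint (x := x)).symm
  rw [this]; rfl

/-- `KeyTheorem640` (hypothesis read in `𝒪_{X,x}`) implies its ISOLATED sibling `KeyTheorem640_isolated`.
[cite: CossartJannsenSaito2020, Thm. 6.40] -/
theorem KeyTheorem640_isolated_of (h : KeyTheorem640.{u}) : KeyTheorem640_isolated.{u} :=
  fun T N len pt hS hC hiso =>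
    h T N len pt hS hC fun i =>
      @noRegularSubschemeInHSLocus_of_isolated _ (T.ln _) N (pt i) (hiso i) 1 le_rfl

/-- `KeyTheorem640_char` implies its ISOLATED sibling `KeyTheorem640_char_isolated`.
[cite: CossartJannsenSaito2020, Thm. 6.40] -/
theorem KeyTheorem640_char_isolated_of (h : KeyTheorem640_char.{u}) : KeyTheorem640_char_isolated.{u} :=
  fun T N len pt hS hchar hC hiso =>
    h T N len pt hS hchar hC fun i =>
      @noRegularSubschemeInHSLocus_of_isolated _ (T.ln _) N (pt i) (hiso i) 1 le_rfl

/-- `KeyTheorem635` (hypothesis read in `𝒪_{X,x}`) gives finiteness of every fundamental sequence over a point isolated in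
the Hilbert–Samuel locus (the case of Rem. 6.36 with the locus of dimension `0`; `e_x(X) ≥ 1` is part of Def. 6.34).
[cite: CossartJannsenSaito2020, Thm. 6.35, Rem. 6.36] -/
theorem KeyTheorem635.finite_of_isolated (h : KeyTheorem635.{u}) (T : BlowupTower.{u}) (N : ℕ) (x : T.X 0) (m : ℕ∞)
    (hS : KeySetting T N) (hF : IsFundamentalSequence T N x m)
    (hiso : @IsIsolatedInHSMaxLocus (T.X 0) (T.ln 0) N x) : m < ⊤ :=
  h T N x m hS hF (@noRegularSubschemeInHSLocus_of_isolated (T.X 0) (T.ln 0) N x hiso _ hF.one_le_dirDim)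

end Literature.AlgebraicGeometry.CossartJannsenSaito2020

end
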